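import Summits.ResolutionOfSingularities.ResolutionOfSingularities.Theorems.IndSmoothValuativeSmoothingRelLURegularCentre
import Literature.AlgebraicGeometry.Resolution.RankOneReductionProofs
import HarnessLib

/-!
# Relative local uniformization of the residue valuation of a composite valuation whose centre
# on the residue model is a regular point of dimension ≤ 2, in every copy of the residue field

Support file for crux stmt-ResolutionOfSingularities-16087 (`ValuativeSmoothing`, route file
`Theses/IndSmooth.lean`), line `birth`, wave 5. Novacoski–Spivakovsky devissage
`ν = ν₁ ∘ ν₂` for a pair of valuation rings `O ≤ O₁` of a field `K ⊇ k`: `ν₁ = ν_{O₁}` and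
`ν₂` is the valuation of the residue field `κ₁ = κ(O₁)` with valuation ring
`Ō = O / 𝔪_{O₁} = residueValuationSubring O O₁ _`. The lead's general composite theorem
(`relLU_of_le_of_relLU_residue`, `IndSmoothValuativeSmoothingRelLUResidueGeneral.lean`) needs
relative local uniformization of `ν₂` INSIDE EVERY bijective copy `ι : κ ≅ κ₁` of the residue
field compatible with `k` (the valuation ring `Ō.comap ι ⊆ κ`). This file supplies it when the
centre of `ν₂` on the residue model is a REGULAR point of dimension `≤ 2`
(`relLU_residue_of_regularCentre`):

Let `s ⊆ O` be finite with `A = k[s] ⊆ O` and suppose the residues of `A` generate `κ₁` as a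
field of fractions (`hres`: every `z ∈ O₁` is `≡ a / b (mod 𝔪_{O₁})` with `a, b ∈ A`,
`ν₁(b) = 0`). Let `Q = 𝔪_O ∩ A ⊇ P = 𝔪_{O₁} ∩ A` be the centres of `ν`, `ν₁` on `A`. In
Novacoski–Spivakovsky's affine language the local ring of the residue model `Ā = A / P ⊆ κ₁` at
the centre of `ν₂` is `A_Q / P A_Q`; IF it is a regular local ring of Krull dimension `≤ 2`
(`hregQ`, `hdimQ`), THEN for every field `κ ⊇ k` and every `k`-compatible bijective ring map
`ι : κ → κ₁` the valuation ring `Ō.comap ι` of `κ` admits relative local uniformization over `k`.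

**Proof.** Let `e : κ ≃ κ₁` be the ring isomorphism underlying `ι` and
`ψ = e⁻¹ ∘ residue : A → κ`, a `k`-algebra map (`hιk`; `exists_residueModelHom`), with image the
finitely generated `k`-subalgebra `B = ψ(A) ⊆ Ō.comap ι` (`range_toSubring_le_comap`). By `hres`
every element of `κ` is a fraction `ψ a / ψ b` (`exists_div_of_residueModelHom`), so
`Frac B = κ`. The local ring `locAtCentre B (Ō.comap ι) = {ψ a / ψ s : s ∉ Q}` of `B` at the
centre of `ν₂ ∘ ι` is carried by `ι` onto the range of the residue lift
`θ : A_Q → κ₁, a / s ↦ ā / s̄` (`map_locAtCentre_range_eq`; a unit criterion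
`(Ō.comap ι).valuation (ψ a) = 1 ↔ a ∉ Q`, `valuation_residueModelHom_eq_one_iff`), and
`θ(A_Q) ≅ A_Q / P A_Q` (`nonempty_quotCentre_ringEquiv_range`, kernel `P A_Q`). Hence
`locAtCentre B (Ō.comap ι) ≅ A_Q / P A_Q` is regular of dimension `≤ 2`
(`IsRegularLocalRing.of_ringEquiv`, `ringKrullDim_eq_of_ringEquiv`), and
`relLU_of_regularCentre` (Zariski–Abhyankar: the quadratic sequence along a valuation
dominating a regular local ring of dimension `≤ 2`, `IndSmoothValuativeSmoothingRelLURegularCentre.lean`)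
applies to the model `B` of `(κ, Ō.comap ι)`.

## Sources

* J. Novacoski, M. Spivakovsky, *Reduction of local uniformization to the rank one case*,
  Valuation Theory in Interaction (Segovia–El Escorial 2011), EMS Ser. Congr. Rep. (2014)
  404–431; arXiv:1204.4751v1: Lemma 2.15, Cor. 2.17, §3.1. [NovacoskiSpivakovsky2014]
* S. S. Abhyankar, *On the valuations centered in a local domain*, Amer. J. Math. 78 (1956),
  Lemma 12. [Abhyankar1956Valuations]
-/

-- single-problem summit: the doubled namespace component is forced
set_option linter.dupNamespace false

namespace Summit.ResolutionOfSingularities.ResolutionOfSingularities.Theorems.ValuativeSmoothing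

open IsLocalRing Literature.AlgebraicGeometry.Resolution

section residueModel

variable {k K : Type} [Field k] [Field K] [Algebra k K]

/-- **The residue map of a model into an abstract copy of the residue field.** For a model
`A ⊆ O₁` over `k` and a `k`-compatible bijective ring map `ι : κ → κ(O₁)` (`hιk`), the map
`ψ = ι⁻¹ ∘ residue : A → κ` is a `k`-algebra map with `ι ∘ ψ = residue`. [folklore] -/
theorem exists_residueModelHom (O₁ : ValuationSubring K) (hk : ∀ c : k, algebraMap k K c ∈ O₁)
    (A : Subalgebra k K) (hAO₁ : A.toSubring ≤ O₁.toSubring) {κ : Type*} [Field κ] [Algebra k κ]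
    (ι : κ →+* ResidueField O₁) (hι : Function.Bijective ι)
    (hιk : ∀ c : k, ι (algebraMap k κ c) = residue O₁ ⟨algebraMap k K c, hk c⟩) :
    ∃ ψ : A →ₐ[k] κ, ∀ a : A, ι (ψ a) = residue O₁ ⟨(a : K), hAO₁ a.2⟩ := by
  let e : κ ≃+* ResidueField O₁ := RingEquiv.ofBijective ι hι
  let φ : A →+* ResidueField O₁ :=
    ((residue O₁).comp (Subring.inclusion hAO₁) : A.toSubring →+* ResidueField O₁)
  have heι : ∀ x : κ, e x = ι x := fun x => rfl
  have hφ : ∀ a : A, φ a = residue O₁ ⟨(a : K), hAO₁ a.2⟩ := fun a => rfl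
  refine ⟨{ (e.symm.toRingHom.comp φ) with commutes' := fun c => ?_ }, fun a => ?_⟩
  · change e.symm (φ (algebraMap k A c)) = algebraMap k κ c
    rw [RingEquiv.symm_apply_eq, heι, hιk, hφ]
    rfl
  · change ι (e.symm (φ a)) = _
    rw [← heι, RingEquiv.apply_symm_apply, hφ]

/-- **The residue model lies in the residue valuation ring.** With `ψ : A → κ` a residue map
of the model `A ⊆ O` (`ι ∘ ψ = residue`, `ι : κ → κ(O₁)`), the image `ψ(A)` lies in the
valuation ring `(O / 𝔪_{O₁}).comap ι` of `κ` (Novacoski–Spivakovsky, Remark 2.4: the residues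
of `O` form the valuation ring of `ν₂`). [folklore] -/
theorem range_toSubring_le_comap (O O₁ : ValuationSubring K) (hO : O ≤ O₁) (A : Subalgebra k K)
    (hA : A.toSubring ≤ O.toSubring) {κ : Type*} [Field κ] [Algebra k κ]
    (ι : κ →+* ResidueField O₁) (ψ : A →ₐ[k] κ)
    (hιψ : ∀ a : A, ι (ψ a) = residue O₁ ⟨(a : K), (hA.trans hO) a.2⟩) :
    ψ.range.toSubring ≤ ((residueValuationSubring O O₁ hO).comap ι).toSubring := by
  intro x hx
  obtain ⟨a, rfl⟩ := (AlgHom.mem_range ψ).mp hx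
  change ι (ψ a) ∈ residueValuationSubring O O₁ hO
  rw [hιψ]
  exact (residue_mem_residueValuationSubring_iff O O₁ hO _).mpr (hA a.2)

/-- **Every element of the copy `κ` of the residue field is a fraction of elements of the
residue model** `ψ(A)`, when the residues of `A` generate `κ(O₁)` as a field of fractions
(`hres`: every `z ∈ O₁` is `≡ a / b (mod 𝔪_{O₁})`, `a, b ∈ A`, `ν₁(b) = 0`) and `ι ∘ ψ = residue`
with `ι : κ → κ(O₁)` injective: `w = ψ a / ψ b`, `ψ b ≠ 0`. [folklore] -/
theorem exists_div_of_residueModelHom (O₁ : ValuationSubring K) (A : Subalgebra k K)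
    (hAO₁ : A.toSubring ≤ O₁.toSubring) {κ : Type*} [Field κ] [Algebra k κ]
    (ι : κ →+* ResidueField O₁) (hιinj : Function.Injective ι) (ψ : A →ₐ[k] κ)
    (hιψ : ∀ a : A, ι (ψ a) = residue O₁ ⟨(a : K), hAO₁ a.2⟩)
    (hres : ∀ z ∈ O₁, ∃ a ∈ A, ∃ b ∈ A, O₁.valuation b = 1 ∧ O₁.valuation (z - a / b) < 1)
    (w : κ) : ∃ x ∈ ψ.range, ∃ y ∈ ψ.range, y ≠ 0 ∧ w = x / y := by
  obtain ⟨z, hz⟩ := residue_surjective (ι w)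
  obtain ⟨a, ha, b, hb, hb1, hzab⟩ := hres z z.2
  have haO₁ : a ∈ O₁ := hAO₁ ha
  have hbO₁ : b ∈ O₁ := hAO₁ hb
  have hbi : b⁻¹ ∈ O₁ := inv_mem_of_valuation_eq_one O₁ hb1
  have hab : a / b ∈ O₁ := by
    rw [div_eq_mul_inv]
    exact mul_mem haO₁ hbi
  have hresb : residue O₁ ⟨b, hbO₁⟩ ≠ 0 := by
    rw [ne_eq, residue_eq_zero_iff, ValuationSubring.valuation_lt_one_iff]
    change ¬ O₁.valuation b < 1
    rw [hb1]
    exact lt_irrefl 1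
  refine ⟨ψ ⟨a, ha⟩, ⟨_, rfl⟩, ψ ⟨b, hb⟩, ⟨_, rfl⟩, ?_, ?_⟩
  · intro h0
    apply hresb
    rw [← hιψ ⟨b, hb⟩, h0, map_zero]
  · apply hιinj
    rw [map_div₀, hιψ, hιψ, ← hz]
    change residue O₁ z = residue O₁ ⟨a, haO₁⟩ / residue O₁ ⟨b, hbO₁⟩
    rw [← residue_div O₁ a b haO₁ hbO₁ hb1 hab, ← sub_eq_zero, ← map_sub, residue_eq_zero_iff,
      ValuationSubring.valuation_lt_one_iff]
    exact hzab

/-- **Unit criterion on the residue model.** For `a ∈ A ⊆ O` with residue map `ψ : A → κ`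
(`ι ∘ ψ = residue`): `ψ a` is a unit of the valuation ring `(O / 𝔪_{O₁}).comap ι` of `κ`
(value `1`) iff `a` lies outside the centre `𝔪_O ∩ A` of `ν` (Novacoski–Spivakovsky,
Remark 2.4 / proof of Lemma 2.15). [folklore] -/
theorem valuation_residueModelHom_eq_one_iff (O O₁ : ValuationSubring K) (hO : O ≤ O₁)
    (A : Subalgebra k K) (hA : A.toSubring ≤ O.toSubring) {κ : Type*} [Field κ] [Algebra k κ]
    (ι : κ →+* ResidueField O₁) (ψ : A →ₐ[k] κ)
    (hιψ : ∀ a : A, ι (ψ a) = residue O₁ ⟨(a : K), (hA.trans hO) a.2⟩) (a : A.toSubring) :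
    ((residueValuationSubring O O₁ hO).comap ι).valuation (ψ a) = 1 ↔
      a ∉ (maximalIdeal O).comap (Subring.inclusion hA) := by
  have hmem : ψ a ∈ (residueValuationSubring O O₁ hO).comap ι :=
    range_toSubring_le_comap O O₁ hO A hA ι ψ hιψ ⟨a, rfl⟩
  rw [notMem_centre_iff_isUnit_residue O O₁ hO A hA a,
    show ψ a = ((⟨ψ a, hmem⟩ : (residueValuationSubring O O₁ hO).comap ι) : κ) from rfl,
    ← ValuationSubring.valuation_eq_one_iff, isUnit_comap_iff]
  have e : (⟨ι (ψ a), hmem⟩ : residueValuationSubring O O₁ hO) =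
      ⟨((residue O₁).comp (Subring.inclusion (hA.trans hO))) a,
        (residue_mem_residueValuationSubring_iff O O₁ hO _).mpr (hA a.2)⟩ :=
    Subtype.ext (hιψ a)
  rw [e]

/-- **The local ring of the residue model at the centre of `ν₂`, inside `κ(O₁)`.** With
`ψ : A → κ` a residue map of the model `A ⊆ O` (`ι ∘ ψ = residue`) and `θ : A_Q → κ(O₁)` the
residue lift (`a / s ↦ ā / s̄`, `Q = 𝔪_O ∩ A`), the map `ι` carries the local ring
`locAtCentre ψ(A) ((O / 𝔪_{O₁}).comap ι)` of the residue model at the centre of `ν₂ ∘ ι` onto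
the range of `θ` (Novacoski–Spivakovsky, proof of Lemma 2.15: `Φ(R_𝔪) = (R/p)_{𝔪/p}` inside
`κ(O₁)`). [cite: NovacoskiSpivakovsky2014, Lemma 2.15] -/
theorem map_locAtCentre_range_eq (O O₁ : ValuationSubring K) (hO : O ≤ O₁) (A : Subalgebra k K)
    (hA : A.toSubring ≤ O.toSubring) {κ : Type*} [Field κ] [Algebra k κ]
    (ι : κ →+* ResidueField O₁) (ψ : A →ₐ[k] κ)
    (hιψ : ∀ a : A, ι (ψ a) = residue O₁ ⟨(a : K), (hA.trans hO) a.2⟩)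
    (θ : Localization.AtPrime ((maximalIdeal O).comap (Subring.inclusion hA)) →+* ResidueField O₁)
    (hθ : ∀ a : A.toSubring, θ (algebraMap A.toSubring _ a)
      = ((residue O₁).comp (Subring.inclusion (hA.trans hO))) a) :
    (locAtCentre ψ.range.toSubring ((residueValuationSubring O O₁ hO).comap ι)).map ι
      = θ.range := by
  have hφ : ∀ a : A.toSubring,
      ((residue O₁).comp (Subring.inclusion (hA.trans hO))) a = ι (ψ a) := fun a => by
    rw [hιψ]
    rfl
  ext y
  rw [mem_range_centreResidueLift_iff O O₁ hO A hA θ hθ, Subring.mem_map]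
  constructor
  · rintro ⟨x, hx, rfl⟩
    obtain ⟨b, hb, u, hu, hu1, rfl⟩ := (mem_locAtCentre_iff).mp hx
    obtain ⟨a, rfl⟩ := (AlgHom.mem_range ψ).mp hb
    obtain ⟨s, rfl⟩ := (AlgHom.mem_range ψ).mp hu
    refine ⟨a, s, (valuation_residueModelHom_eq_one_iff O O₁ hO A hA ι ψ hιψ s).mp hu1, ?_⟩
    rw [map_div₀, hφ, hφ]
  · rintro ⟨a, s, hs, rfl⟩
    refine ⟨ψ a / ψ s, ?_, by rw [map_div₀, hφ, hφ]⟩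
    exact ⟨ψ a, ⟨a, rfl⟩, ψ s, ⟨s, rfl⟩,
      (valuation_residueModelHom_eq_one_iff O O₁ hO A hA ι ψ hιψ s).mpr hs, rfl⟩

/-- **`A_Q / P A_Q ≅` the local ring of the residue model at the centre of `ν₂`**
(Novacoski–Spivakovsky, Lemma 2.15 / Cor. 2.17: `R / p` localised at `𝔪 / p` is the local ring
of `ν₂` on the residue model), realised in the copy `κ` of the residue field: for `A ⊆ O` with
centres `Q = 𝔪_O ∩ A ⊇ P = 𝔪_{O₁} ∩ A` and a residue map `ψ : A → κ` (`ι ∘ ψ = residue`,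
`ι : κ → κ(O₁)` injective), `A_Q / P A_Q ≃+* locAtCentre ψ(A) ((O / 𝔪_{O₁}).comap ι)`.
[cite: NovacoskiSpivakovsky2014, Lemma 2.15] -/
theorem nonempty_quotCentre_ringEquiv_locAtCentre (O O₁ : ValuationSubring K) (hO : O ≤ O₁)
    (A : Subalgebra k K) (hA : A.toSubring ≤ O.toSubring) {κ : Type*} [Field κ] [Algebra k κ]
    (ι : κ →+* ResidueField O₁) (hιinj : Function.Injective ι) (ψ : A →ₐ[k] κ)
    (hιψ : ∀ a : A, ι (ψ a) = residue O₁ ⟨(a : K), (hA.trans hO) a.2⟩) :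
    Nonempty
      ((Localization.AtPrime ((maximalIdeal O).comap (Subring.inclusion hA)) ⧸
        ((maximalIdeal O₁).comap (Subring.inclusion (hA.trans hO))).map
          (algebraMap A.toSubring
            (Localization.AtPrime ((maximalIdeal O).comap (Subring.inclusion hA))))) ≃+*
        locAtCentre ψ.range.toSubring ((residueValuationSubring O O₁ hO).comap ι)) := by
  obtain ⟨θ, hθ⟩ := exists_centreResidueLift O O₁ hO A hA
  obtain ⟨e₃⟩ := nonempty_quotCentre_ringEquiv_range O O₁ hO A hA θ hθ
  have hmap := map_locAtCentre_range_eq O O₁ hO A hA ι ψ hιψ θ hθ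
  exact ⟨e₃.trans ((RingEquiv.subringCongr hmap).symm.trans
    (Subring.equivMapOfInjective _ ι hιinj).symm)⟩

/-- **Relative local uniformization of the residue valuation in a copy of the residue field,
from a regular centre of dimension `≤ 2` on a residue model** (model form). For `O ≤ O₁`
valuation rings of `K ⊇ k`, a finitely generated model `A ⊆ O` whose residues generate
`κ(O₁)` as a field of fractions (`hres`), with `A_Q / P A_Q` (`Q ⊇ P` the centres of `ν`, `ν₁`)
regular of Krull dimension `≤ 2`, and a `k`-compatible bijective `ι : κ → κ(O₁)`: the valuation
ring `(O / 𝔪_{O₁}).comap ι` of `κ` admits relative local uniformization over `k`. Proof: the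
residue model `B = ψ(A) ⊆ κ` is finitely generated with `Frac B = κ` and
`locAtCentre B _ ≅ A_Q / P A_Q`; apply `relLU_of_regularCentre`.
[cite: NovacoskiSpivakovsky2014, Cor. 2.17] -/
theorem relLU_residue_of_regularCentre_model (O O₁ : ValuationSubring K) (hO : O ≤ O₁)
    (hk : ∀ c : k, algebraMap k K c ∈ O₁) (A : Subalgebra k K) (hAfg : A.FG)
    (hA : A.toSubring ≤ O.toSubring)
    (hres : ∀ z ∈ O₁, ∃ a ∈ A, ∃ b ∈ A, O₁.valuation b = 1 ∧ O₁.valuation (z - a / b) < 1)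
    (hregQ : IsRegularLocalRing
      (Localization.AtPrime ((maximalIdeal O).comap (Subring.inclusion hA)) ⧸
        ((maximalIdeal O₁).comap (Subring.inclusion (hA.trans hO))).map
          (algebraMap A.toSubring
            (Localization.AtPrime ((maximalIdeal O).comap (Subring.inclusion hA))))))
    (hdimQ : ringKrullDim
      (Localization.AtPrime ((maximalIdeal O).comap (Subring.inclusion hA)) ⧸
        ((maximalIdeal O₁).comap (Subring.inclusion (hA.trans hO))).map
          (algebraMap A.toSubring
            (Localization.AtPrime ((maximalIdeal O).comap (Subring.inclusion hA))))) ≤ 2)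
    (κ : Type) [Field κ] [Algebra k κ] (ι : κ →+* ResidueField O₁) (hι : Function.Bijective ι)
    (hιk : ∀ c : k, ι (algebraMap k κ c) = residue O₁ ⟨algebraMap k K c, hk c⟩) :
    RelLocalUniformization k κ ((residueValuationSubring O O₁ hO).comap ι) := by
  obtain ⟨ψ, hιψ⟩ := exists_residueModelHom O₁ hk A (hA.trans hO) ι hι hιk
  have hBfg : ψ.range.FG := by
    rw [← Algebra.map_top]
    exact ((Subalgebra.fg_top A).mpr hAfg).map ψ
  have hBW := range_toSubring_le_comap O O₁ hO A hA ι ψ hιψ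
  have hfrac := exists_div_of_residueModelHom O₁ A (hA.trans hO) ι hι.1 ψ hιψ hres
  obtain ⟨E⟩ := nonempty_quotCentre_ringEquiv_locAtCentre O O₁ hO A hA ι hι.1 ψ hιψ
  haveI := hregQ
  have hreg : IsRegularLocalRing
      (locAtCentre ψ.range.toSubring ((residueValuationSubring O O₁ hO).comap ι)) :=
    IsRegularLocalRing.of_ringEquiv
      (R := Localization.AtPrime ((maximalIdeal O).comap (Subring.inclusion hA)) ⧸
        ((maximalIdeal O₁).comap (Subring.inclusion (hA.trans hO))).map
          (algebraMap A.toSubring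
            (Localization.AtPrime ((maximalIdeal O).comap (Subring.inclusion hA))))) E
  have hdim : ringKrullDim
      (locAtCentre ψ.range.toSubring ((residueValuationSubring O O₁ hO).comap ι)) ≤ 2 := by
    rw [← ringKrullDim_eq_of_ringEquiv
      (R := Localization.AtPrime ((maximalIdeal O).comap (Subring.inclusion hA)) ⧸
        ((maximalIdeal O₁).comap (Subring.inclusion (hA.trans hO))).map
          (algebraMap A.toSubring
            (Localization.AtPrime ((maximalIdeal O).comap (Subring.inclusion hA))))) E]
    exact hdimQ
  exact relLU_of_regularCentre k κ _ ψ.range hBfg hBW hfrac hreg hdim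

end residueModel

/-- **Relative local uniformization of the residue valuation `ν₂` of a composite valuation
`ν = ν₁ ∘ ν₂` in every bijective copy of the residue field, when the centre of `ν₂` on the
residue model is a regular point of dimension `≤ 2`** (Novacoski–Spivakovsky devissage, the
input of Cor. 2.17, discharged by Zariski–Abhyankar uniformization of valuations dominating a
regular local ring of dimension `≤ 2`). For fields `k ⊆ K`, valuation rings `O ≤ O₁` of `K`
with `k ⊆ O₁`, a finite `s ⊆ O` with `A = k[s] ⊆ O` whose residues generate `κ(O₁)` as a field
of fractions (`hres`), such that `A_Q / P A_Q` (`Q = 𝔪_O ∩ A ⊇ P = 𝔪_{O₁} ∩ A`) is a regular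
local ring of Krull dimension `≤ 2`: for every field `κ ⊇ k` and every bijective ring map
`ι : κ → κ(O₁)` compatible with `k`, the valuation ring `(O / 𝔪_{O₁}).comap ι` of `κ` admits
relative local uniformization over `k`. This is `relLU_residue_of_regularCentre_model` for the
model `k[s]`. [cite: NovacoskiSpivakovsky2014, Cor. 2.17] -/
theorem relLU_residue_of_regularCentre (k K : Type) [Field k] [Field K] [Algebra k K]
    (O O₁ : ValuationSubring K) (hO : O ≤ O₁) (hk : ∀ c : k, algebraMap k K c ∈ O₁)
    (s : Finset K) (hA : (Algebra.adjoin k (↑s : Set K)).toSubring ≤ O.toSubring)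
    (hres : ∀ z ∈ O₁, ∃ a ∈ Algebra.adjoin k (↑s : Set K), ∃ b ∈ Algebra.adjoin k (↑s : Set K),
      O₁.valuation b = 1 ∧ O₁.valuation (z - a / b) < 1)
    (hregQ : IsRegularLocalRing
      (Localization.AtPrime ((maximalIdeal O).comap (Subring.inclusion hA)) ⧸
        ((maximalIdeal O₁).comap (Subring.inclusion (hA.trans hO))).map
          (algebraMap (Algebra.adjoin k (↑s : Set K)).toSubring
            (Localization.AtPrime ((maximalIdeal O).comap (Subring.inclusion hA))))))
    (hdimQ : ringKrullDim
      (Localization.AtPrime ((maximalIdeal O).comap (Subring.inclusion hA)) ⧸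
        ((maximalIdeal O₁).comap (Subring.inclusion (hA.trans hO))).map
          (algebraMap (Algebra.adjoin k (↑s : Set K)).toSubring
            (Localization.AtPrime ((maximalIdeal O).comap (Subring.inclusion hA))))) ≤ 2)
    (κ : Type) [Field κ] [Algebra k κ] (ι : κ →+* ResidueField O₁) (hι : Function.Bijective ι)
    (hιk : ∀ c : k, ι (algebraMap k κ c) = residue O₁ ⟨algebraMap k K c, hk c⟩) :
    RelLocalUniformization k κ ((residueValuationSubring O O₁ hO).comap ι) :=
  relLU_residue_of_regularCentre_model O O₁ hO hk (Algebra.adjoin k (↑s : Set K))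
    (Subalgebra.fg_adjoin_finset s) hA hres hregQ hdimQ κ ι hι hιk

end Summit.ResolutionOfSingularities.ResolutionOfSingularities.Theorems.ValuativeSmoothing
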